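import Literature.NumberTheory.GelbartRogawski1991.DoubledUnitarySiegelParabolicAlgebra
import HarnessLib

/-!
# Siegel sections and the Siegel–hermitian Eisenstein series on the DOUBLED unitary group `U(𝕍 ⊕ −𝕍)(𝔸)`

Topic `NumberTheory/K2Lit` (Track B build stream 29, leaf D2-bis of the in-house road for Liu 2021 Thm. B.4 (1),
planner `hodgecm-mathlib-K2Liu-plan`; companion of `K2Lit/SiegelEisensteinSeriesUnitary` (the SPLIT model
`U(J_{m,m})`)). Definitions and proved lemmas only: **no `sorry`, no named fact, no instance, no notation.**

**Why a second carrier.** The doubling method ([PSR87]; Liu 2021 App. B §B.3 at `a = 0`; Harris–Kudla–Sweet 1996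
§1) integrates a cusp form on `G × G = U(𝕍) × U(−𝕍)` against the Siegel Eisenstein series of the DOUBLED group
`H = U(𝕍 ⊕ −𝕍)` relative to the Siegel parabolic `P_Δ = Stab(Δ)`, `Δ = {(x, x)}` the diagonal Lagrangian. For
the CM datum of record (`𝕍 = V ⊗ W` with diagonal Gram matrices — the datum of the tree's theta kernels) all of
this GROUP THEORY is already in the tree (★ `GelbartRogawski1991.GRConstruction`): `HA` = `H(𝔸)` :148,
`IsSiegelDelta` :159, `deltaBlock` ∕ `detDelta` :165–170, `ratH` = `H(L⁺)` :174, `chiDet χ p = χ(det_Δ p)` :273,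
`modDelta p = |det_Δ p|_{𝔸_L}^{1/2}` :277 (`DoubledUnitaryGlobalSplittingData`), and the closure ∕ multiplicativity
lemmas `isSiegelDelta_mul ∕ _inv ∕ _one'`, `detDelta_mul`, `chiDet_mul`, `modDelta_mul`
(`DoubledUnitarySiegelParabolicAlgebra`). This file only PACKAGES them for the Eisenstein series:

* `siegelDelta` — `P_Δ(𝔸)` as a `Subgroup` of `H(𝔸)` (from the ★ closure lemmas);
* `siegelDeltaCharacter χ s p = χ(det_Δ p) · |det_Δ p|_{𝔸_L}^{s + n/2}` — the character of `P_Δ(𝔸)` defining the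
  degenerate principal series `I(s, χ) = Ind_{P_Δ(𝔸)}^{H(𝔸)} (χ |·|_L^s ∘ det_Δ)` (unitary normalisation,
  `ρ_{P_Δ} ↔ n/2` for `H = U(n, n)`; written as `chiDet χ p · (modDelta p)^{2s + n}`), multiplicative on `P_Δ(𝔸)`
  (`siegelDeltaCharacter_mul`, from ★ `chiDet_mul`, `modDelta_mul`);
* `IsSiegelDeltaSection χ s f` — `f(p h) = siegelDeltaCharacter χ s p · f(h)`;
* `siegelDeltaRat = P_Δ(L⁺) ≤ H(L⁺)`, `SiegelDeltaQuot = P_Δ(L⁺) \ H(L⁺)`, and the **Siegel–hermitian Eisenstein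
  series** `eisensteinSeriesDelta f h = ∑'_{γ ∈ P_Δ(L⁺)\H(L⁺)} f(γ h)` (`tsum` over the quotient by LEFT
  multiplication, each class read at `Quotient.out`; representative-independence for sections and absolute
  convergence for `Re s > n/2` are the planned Theorems files `K2LiuSiegelEisensteinDoubledWellDefined` ∕
  `…Convergence`; off the domain of summability `tsum`'s junk value `0`). Pole notions wait for STANDARD sections
  (as in the split-model file).

References: Liu 2021, App. B §B.3 p. 101 and Lem. B.10 (2) p. 102 (the series `E_{P_a}(·; f_{a,s})`, here `a = 0`);
V. Tan 1999 §1 (Siegel Eisenstein series on `U(n,n)`); Gelbart–Rogawski 1991 §3.1 (the doubled group of the datum).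
-/

noncomputable section

open scoped Matrix
open NumberField IsDedekindDomain

namespace Literature.NumberTheory.K2Lit.SiegelDoubled

open Literature.NumberTheory.Automorphic Literature.NumberTheory.GaloisRepresentations
open Literature.NumberTheory.GelbartRogawski1991 Literature.NumberTheory.GelbartRogawski1991.GRConstruction

variable (L : Type) [Field L] [NumberField L] [IsCMField L]
variable {N M n : ℕ} (e : Fin N × Fin M ≃ Fin n)
  (dV : Fin N → L) (hdV : ∀ i, IsCMField.complexConj L (dV i) = dV i)
  (dW : Fin M → L) (hdW : ∀ i, IsCMField.complexConj L (dW i) = dW i)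

/-! ## 1. `P_Δ(𝔸)` as a subgroup -/

/-- **The adelic Siegel parabolic `P_Δ(𝔸) ≤ H(𝔸) = U(𝕍 ⊕ −𝕍)(𝔸)`** — the stabiliser of the diagonal
Lagrangian `Δ`, i.e. ★ `IsSiegelDelta`, packaged as a `Subgroup` via ★ `isSiegelDelta_one' ∕ _mul ∕ _inv`.
[cite: Liu2021, §B.3 p. 101] -/
def siegelDelta : Subgroup (HA L e dV hdV dW hdW) where
  carrier := {p | IsSiegelDelta L e dV hdV dW hdW p}
  one_mem' := isSiegelDelta_one' L e dV hdV dW hdW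
  mul_mem' hp hq := isSiegelDelta_mul L e dV hdV dW hdW hp hq
  inv_mem' hp := isSiegelDelta_inv L e dV hdV dW hdW hp

/-- Membership in `P_Δ(𝔸)` is ★ `IsSiegelDelta`. [cite: Liu2021, §B.3 p. 101] -/
theorem mem_siegelDelta_iff (p : HA L e dV hdV dW hdW) :
    p ∈ siegelDelta L e dV hdV dW hdW ↔ IsSiegelDelta L e dV hdV dW hdW p :=
  Iff.rfl

/-! ## 2. The inducing character and Siegel sections -/

/-- **`p ↦ χ(det_Δ p) · |det_Δ p|_{𝔸_L}^{s + n/2}`** on `H(𝔸)` (meaningful on `P_Δ(𝔸)`): the character inducing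
`I(s, χ) = Ind_{P_Δ(𝔸)}^{H(𝔸)} (χ |·|_L^s ∘ det_Δ)` in the unitary normalisation; `|det_Δ p|^{s + n/2}` is written
`(modDelta p)^{2s + n}` with ★ `modDelta p = |det_Δ p|^{1/2}` (a positive real, so the complex power is the
principal one). Liu 2021 §B.3: «J_a(s, μᶜ) … the normalized induced representation Ind (μᶜ · |·|^s) ∘ det»; Tan 1999 §1.
[cite: Liu2021, §B.3 p. 101] [cite: Tan1999, §1] -/
def siegelDeltaCharacter (χ : HeckeCharacter L) (s : ℂ) (p : HA L e dV hdV dW hdW) : ℂ :=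
  ((chiDet L e dV hdV dW hdW χ p : ℂˣ) : ℂ) * ((modDelta L e dV hdV dW hdW p : ℂ) ^ (2 * s + (n : ℂ)))

/-- ★ `modDelta` is positive (a square root of an idele norm, or `1`). [cite: Tan1999, §1] -/
theorem modDelta_pos (p : HA L e dV hdV dW hdW) : 0 < modDelta L e dV hdV dW hdW p := by
  unfold modDelta
  split_ifs with hu
  · exact Real.sqrt_pos.2 (ideleNorm_pos _)
  · exact one_pos

/-- The inducing character is multiplicative on `P_Δ(𝔸)` (from ★ `chiDet_mul`, `modDelta_mul`).
[cite: Tan1999, §1] -/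
theorem siegelDeltaCharacter_mul (χ : HeckeCharacter L) (s : ℂ) {p q : HA L e dV hdV dW hdW}
    (hp : IsSiegelDelta L e dV hdV dW hdW p) (hq : IsSiegelDelta L e dV hdV dW hdW q) :
    siegelDeltaCharacter L e dV hdV dW hdW χ s (p * q) =
      siegelDeltaCharacter L e dV hdV dW hdW χ s p * siegelDeltaCharacter L e dV hdV dW hdW χ s q := by
  unfold siegelDeltaCharacter
  rw [chiDet_mul L e dV hdV dW hdW χ hp hq, modDelta_mul L e dV hdV dW hdW hp hq, Units.val_mul,
    Complex.ofReal_mul, Complex.mul_cpow_ofReal_nonneg (le_of_lt (modDelta_pos L e dV hdV dW hdW p))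
      (le_of_lt (modDelta_pos L e dV hdV dW hdW q))]
  ring

/-- The inducing character at `1` is `1`. [cite: Tan1999, §1] -/
theorem siegelDeltaCharacter_one (χ : HeckeCharacter L) (s : ℂ) :
    siegelDeltaCharacter L e dV hdV dW hdW χ s 1 = 1 := by
  unfold siegelDeltaCharacter
  rw [chiDet_one', modDelta_one']
  simp

/-- **Siegel sections of `I(s, χ)`** on the doubled group: `f : H(𝔸) → ℂ` with
`f(p h) = χ(det_Δ p)|det_Δ p|^{s+n/2} f(h)` for `p ∈ P_Δ(𝔸)` (smoothness ∕ `K`-finiteness ∕ standardness are added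
by the standard-section leaf). [cite: Tan1999, §1] [cite: Liu2021, Lem. B.10 p. 102] -/
def IsSiegelDeltaSection (χ : HeckeCharacter L) (s : ℂ) (f : HA L e dV hdV dW hdW → ℂ) : Prop :=
  ∀ p : HA L e dV hdV dW hdW, IsSiegelDelta L e dV hdV dW hdW p →
    ∀ h : HA L e dV hdV dW hdW, f (p * h) = siegelDeltaCharacter L e dV hdV dW hdW χ s p * f h

/-- A family `s ↦ f_s` of Siegel sections. [cite: Tan1999, §1] -/
def IsSiegelDeltaSectionFamily (χ : HeckeCharacter L) (f : ℂ → HA L e dV hdV dW hdW → ℂ) : Prop :=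
  ∀ s : ℂ, IsSiegelDeltaSection L e dV hdV dW hdW χ s (f s)

/-- The zero function is a Siegel section (so the notion is inhabited; the interesting sections — Siegel–Weil
sections `h ↦ ω(h)Φ(0)` at `s₀` and their standard extensions — come with the section leaf).
[cite: Tan1999, §1] -/
theorem isSiegelDeltaSection_zero (χ : HeckeCharacter L) (s : ℂ) :
    IsSiegelDeltaSection L e dV hdV dW hdW χ s (fun _ => 0) := by
  intro p _ h
  simp

/-! ## 3. `P_Δ(L⁺) \ H(L⁺)` and the Eisenstein series -/

/-- **The rational Siegel parabolic `P_Δ(L⁺) ≤ H(L⁺)`** (★ `ratH` = the rational points, as a subgroup of `H(𝔸)`).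
[cite: Liu2021, §B.3 p. 101] -/
def siegelDeltaRat : Subgroup (ratH L e dV hdV dW hdW) :=
  (siegelDelta L e dV hdV dW hdW).subgroupOf (ratH L e dV hdV dW hdW)

/-- **`P_Δ(L⁺) \ H(L⁺)`**: orbits of `P_Δ(L⁺)` on `H(L⁺)` by left multiplication. [cite: Liu2021, §B.3 p. 101] -/
def SiegelDeltaQuot : Type :=
  Quotient (MulAction.orbitRel (siegelDeltaRat L e dV hdV dW hdW) (ratH L e dV hdV dW hdW))

/-- **The Siegel–hermitian Eisenstein series of the doubled group**,
`E(h; f) = Σ_{γ ∈ P_Δ(L⁺)\H(L⁺)} f(γ h)` (Liu 2021 §B.3 `E_{P_a}(·; f_{a,s})` at `a = 0`; Tan 1999 §1): the `tsum`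
over the coset space, each coset read at a chosen representative (`Quotient.out`). For a Siegel section the
summand is independent of the representative (planned lemma: `χ` is trivial on `L^×` and the product formula
kills `|det_Δ γ|`), and the series converges absolutely for `Re s > n/2` (planned lemma); elsewhere the junk
value `0` of `tsum`. [cite: Liu2021, Lem. B.10 (2) p. 102] [cite: Tan1999, §1] -/
def eisensteinSeriesDelta (f : HA L e dV hdV dW hdW → ℂ) (h : HA L e dV hdV dW hdW) : ℂ :=
  ∑' q : SiegelDeltaQuot L e dV hdV dW hdW,
    f (((Quotient.out q : ratH L e dV hdV dW hdW) : HA L e dV hdV dW hdW) * h)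

/-- `E(h; f_s)` for a family of sections. [cite: Tan1999, §1] -/
def eisensteinFamilyDelta (f : ℂ → HA L e dV hdV dW hdW → ℂ) (s : ℂ) (h : HA L e dV hdV dW hdW) : ℂ :=
  eisensteinSeriesDelta L e dV hdV dW hdW (f s) h

/-- The Eisenstein series of the zero section vanishes. [cite: Tan1999, §1] -/
theorem eisensteinSeriesDelta_zero (h : HA L e dV hdV dW hdW) :
    eisensteinSeriesDelta L e dV hdV dW hdW (fun _ => 0) h = 0 := by
  simp [eisensteinSeriesDelta]

end Literature.NumberTheory.K2Lit.SiegelDoubled
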